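import Mathlib.Data.Setoid.Basic
import Mathlib.Data.Matrix.Mul
import Mathlib.Data.Real.Basic
import Mathlib.Data.Fintype.Powerset
import Mathlib.Data.Fintype.Sum
import Mathlib.Data.Fintype.Pi
import Mathlib.Algebra.BigOperators.Fin
import Mathlib.Algebra.BigOperators.Field
import Mathlib.LinearAlgebra.Matrix.ToLin
import Mathlib.Tactic.Positivity
import Mathlib.Tactic.Ring
import Mathlib.Analysis.Complex.ReImTopology
import Mathlib.Analysis.Complex.Convex
import Literature.Probability.LatticeModels.PercolationRowTransfer
import Literature.Probability.LatticeModels.DomainDiscretisation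
import Literature.Probability.LatticeModels.PlanarIsing
import Literature.Probability.Percolation.CardyFormula
import HarnessLib

/-!
# Two-star connectivity states, wire letters, and the word of a marked lattice polygon

Continuation of `Literature.Probability.LatticeModels.PercolationRowTransfer` (one-star row
connectivity states `RowState S`, the stochastic Temperley–Lieb(`β = 1`) row-to-row transfer
matrix `PercolationRowTransfer S` of bond percolation on `ℤ²` at `p = 1/2`, junctions). Requested by
route `CriticalPhenomena/CardyPolygonWords` (item `WordSewing` and its foreseen split
`RowTransferExactness` / `JunctionOverlapLimit` / `ConformalComposition`; cards
`tl-spectral-kleban-zagier`, `jordan-free-crossing-module`).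

Sources. The row-to-row transfer matrix acting on *connectivity states* (set partitions of the
current row recording which sites are joined below it) is the standard device for cluster /
loop models on strips: Blöte–Nightingale (1982); Cardy, *Conformal invariance and percolation*,
arXiv:math-ph/0103018, §3.3 (transfer matrix between neighbouring rows) and §7.1 (the crossing
probability of a rectangle as a matrix element `⟨a| T^W |b⟩` between boundary states)
(`Cardy2001`); Bondesan–Jacobsen–Saleur, Nucl. Phys. B 867 (2013), arXiv:1207.7005, §5 (loop model
on link states = "patterns of connectivities of sites", lattice amplitudes `⟨B| T^{L'} |B'⟩`)
(`BondesanJacobsenSaleur2012`); Jacobsen–Zinn-Justin, J. Phys. A 35 (2002), arXiv:cond-mat/0111374,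
§§3–4 (critical bond percolation on the square lattice, weight one per bond configuration, transfer
matrix on the basis of planar connectivities, factorised `T(L) = H₁ ⋯ H_L · V₁ ⋯ V_L` into
single vertical-bond and horizontal-bond matrices — our `vertRel₂` then `horizRel₂`)
(`JacobsenZinnjustin2001`). The percolation crossing event needs TWO marked classes:
"joined (below the current row) to the discrete arc `(ab)`" and "… to the discrete arc `(cd)`";
we record them by two extra points `⋆_A = ⋆ 0`, `⋆_B = ⋆ 1` adjoined to every row. Everything
below is finite and elementary; this file only sets up DEFINITIONS (plus bookkeeping lemmas:
stochasticity, mass preservation, amplitudes in `[0, 1]`) and states ONE named fact,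
`RowTransferExactness`, the dictionary between the G02 crossing probability
`Literature.Probability.Percolation.bondDomainCrossingProb` and the word amplitude.

Contents (all in `namespace Literature.Probability.LatticeModels`; `S : Finset ℤ` a column set):

* `RowPoint₂ S = S ⊕ Fin 2`, `RowState₂ S` (set partitions of `RowPoint₂ S`, one-field wrapper of
  a `Setoid`; a `Fintype`), `RowState₂.free` (all singletons), `RowState₂.StarsJoined`
  (`⋆_A ~ ⋆_B`).
* The edge-by-edge row step, VERBATIM from the one-star file with both stars always "up":
  `IsUp₂`, `vertRel₂`, `joinTwo₂`, `hEdgeRel₂`, `horizRel₂`, `rowStep₂ O H`; the stochastic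
  transfer matrix `PercolationRowTransfer₂ S` (`T π π' = ℙ(rowStep₂ O H π = π')`, `O ⊆ S` and
  `H ⊆ hEdges S` uniform), `sum_percolationRowTransfer₂_eq_one`; as a linear map on distributions
  (row vectors) `transferLin₂`.
* Junctions for `S ⊆ S'`, verbatim: `insertState₂` (new columns singletons), `restrictState₂`
  (`Setoid.comap` along the inclusion, stars kept), `junctionInsert₂`, `junctionRestrict₂`.
* WIRE letters: `wire A i π = π ⊔ ⨆_{a ∈ A} joinTwo₂ (inl a) (⋆ i)` joins every column of
  `A : Finset S` to the star `i`, `wirePush A i` its push-forward on distributions; `wire_joins`.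
* Boundary data: `rowInit₂ S` (Dirac mass at `RowState₂.free S`) and the read-out `rowReadout₂ S`
  (indicator of `StarsJoined`).
* Words. `rowLetter S S' W_A W_B` = restrict to `S ∩ S'`, insert into `S'`, apply `T_{S'}`, wire
  `W_A` to `⋆_A` and `W_B` to `⋆_B` (one row of the lattice; a linear map on distributions). For a
  finite vertex set `V : Finset (Site 2)` with wire sets `W_A, W_B : Set (Site 2)`:
  `rowCols V y` (the columns of row `y`), `rowWires W S y`, the distribution
  `latticeWordDist V W_A W_B b n` of the connectivity state of row `b + n` produced by the rows
  `b + 1, …, b + n`, started from `rowInit₂` on row `b`, and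
  `latticeWordAmplitude V W_A W_B b n = ⟨latticeWordDist, rowReadout₂⟩`;
  `latticeCrossingAmplitude V W_A W_B` takes `b = wordBaseRow V` (one below the lowest row) and
  `n = wordRowCount V` (up to the highest row).
* The polygon word: `polygonWordAmplitude R δ` for a conformal rectangle `R` at mesh `δ` is the
  lattice crossing amplitude of `V = meshDomainFinset R.carrier δ` (G02 discrete domain `Ω_δ`)
  wired along G02's discrete arcs `discreteArc R.carrier δ (R.arc 0)` (to `⋆_A`) and
  `discreteArc R.carrier δ (R.arc 2)` (to `⋆_B`), with G02's `≤` tie rule untouched (a vertex on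
  both discrete arcs is wired to both stars). `polyominoCarrier δ₀ s` is the open polyomino of
  `CardyLatticePolygon` (interior of a finite union of closed `δ₀`-squares).
* Named fact `RowTransferExactness` [folklore bookkeeping; route support item]: for a conformal
  rectangle whose carrier is `polyominoCarrier δ₀ s`, at every aligned mesh `δ = δ₀ / N`,
  `bondDomainCrossingProb R δ = polygonWordAmplitude R δ`.
* Its geometric half, PROVED: `polyominoSquare`, the probe lemma
  `floorSquare_mem_of_mem_meshVertices` (a mesh vertex's floor square belongs to the polyomino),
  `meshGraph_adj_of_zdGraph_adj_polyomino` and `discreteDomainGraph_adj_iff_polyomino` — at an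
  aligned mesh the G02 graph `Ω_δ` of a lattice polygon is the subgraph of `ℤ²` INDUCED on
  `meshDomain` (every `ℤ²`-edge between two of its vertices has its closed segment in `Ω̄`), which
  is what lets the word use all nearest-neighbour edges inside `V`.

Design notes.
* Why `polygonWordAmplitude` takes `(R, δ)` and not `(s, marks, N)`: the wires are G02's METRIC
  discrete arcs (`discreteArc`: boundary vertices at least as close to the arc as to the rest of
  `∂Ω`, ties to both), which need the continuum marked domain; the combinatorial data enter through
  the hypothesis `R.carrier = polyominoCarrier δ₀ s` exactly as in `CardyLatticePolygon`. At an
  aligned mesh `δ₀ / N` the mesh vertices are the sites `x` with `x / N` interior to the polyomino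
  (`floorSquare_mem_of_mem_meshVertices` is the useful half of this), so — whenever these induce a
  connected graph, e.g. for `N ≥ 2` — the column sets `rowCols (meshDomainFinset Ω (δ₀/N)) y` are
  the interior lattice points of row `y` of the `N`-times refined polyomino (not proved here).
* In `rowLetter` the transfer matrix `T_{S'}` also draws (irrelevant) vertical edges below the
  freshly inserted columns `S' \ S`: an inserted column is a singleton class, and `vertRel₂` keeps a
  singleton a singleton whatever its vertical edge, so the distribution is that of the honest
  step "vertical layer on `S ∩ S'`, horizontal layer on `S'`" — this is what makes polygons words
  in the letters `T_S`, `J`, `wire` (BJS §5; Cardy §7.1).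
* Rows outside the vertex set are harmless: a letter `∅ → ∅` is the identity, and restriction /
  insertion / the vertical layer never change whether `⋆_A ~ ⋆_B`
  (`starsJoined_restrictState₂`, `starsJoined_insertState₂`, `starsJoined_vertRel₂`).
* Distributions are row vectors (`μ ᵥ* T`), as in the one-star file; all maps are mass-preserving
  (`sum_rowLetter`, `sum_latticeWordDist`) and positivity-preserving, whence
  `polygonWordAmplitude_mem_Icc`.
* Not here: planarity (non-crossing) of reachable states, the spectral theory of `T_S`, the
  identification of `meshDomain` of a polyomino with its interior lattice points, and the
  probabilistic half of `RowTransferExactness` (finite Markov bookkeeping row by row + a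
  cylinder-set marginal of Mathlib's `setBernoulli`); these are route items.
-/

noncomputable section

open Finset Matrix
open scoped BigOperators Classical

namespace Literature.Probability.LatticeModels

/-! ### Two-star row points and connectivity states -/

/-- The points of a row over the column set `S` together with two extra symbols `⋆_A = inr 0`
("joined below the row to the discrete arc `(ab)`") and `⋆_B = inr 1` ("… to the discrete arc
`(cd)`"): the marked boundary classes of the connectivity transfer matrix.
[cite: Cardy2001, §7.1] -/
abbrev RowPoint₂ (S : Finset ℤ) : Type := (S : Type) ⊕ Fin 2

/-- The star `⋆ i` (`i = 0`: the arc `(ab)`; `i = 1`: the arc `(cd)`). [cite: Cardy2001, §7.1] -/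
def RowPoint₂.star (S : Finset ℤ) (i : Fin 2) : RowPoint₂ S := Sum.inr i

/-- A **two-star row connectivity state**: a set partition of the row sites and the two stars
(which sites are joined to each other / to which discrete arc by open paths below the row).
One-field wrapper of `Setoid (RowPoint₂ S)`; all partitions are allowed as index set.
[cite: BondesanJacobsenSaleur2012, §5 (link states: patterns of connectivities)] -/
@[ext]
structure RowState₂ (S : Finset ℤ) where
  /-- The underlying equivalence relation "is joined to". -/
  rel : Setoid (RowPoint₂ S)

namespace RowState₂

variable {S : Finset ℤ}

/-- Two-star connectivity states form a finite set (partitions of a finite set). [folklore] -/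
instance instFinite : Finite (RowState₂ S) := by
  refine Finite.of_injective (fun π : RowState₂ S => fun a b : RowPoint₂ S => π.rel a b) ?_
  intro π ρ h
  ext a b
  exact iff_of_eq (congrFun (congrFun h a) b)

/-- Two-star connectivity states form a `Fintype` (noncomputably). [folklore] -/
instance instFintype : Fintype (RowState₂ S) := Fintype.ofFinite _

/-- The totally disconnected state: all classes (sites and both stars) are singletons; the
initial state below the lowest row of a polygon. [folklore] -/
def free (S : Finset ℤ) : RowState₂ S := ⟨⊥⟩

/-- The site `x` is joined to the star `⋆ i` in the state `π`. [cite: Cardy2001, §7.1] -/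
def JoinedToStar (π : RowState₂ S) (x : S) (i : Fin 2) : Prop :=
  π.rel (Sum.inl x) (RowPoint₂.star S i)

/-- The two stars are joined in `π`: an open path from the discrete arc `(ab)` to the discrete arc
`(cd)` has been completed below (or in) the current row. [cite: Cardy2001, §7.1] -/
def StarsJoined (π : RowState₂ S) : Prop :=
  π.rel (RowPoint₂.star S 0) (RowPoint₂.star S 1)

/-- The free state inhabits `RowState₂ S`. [folklore] -/
instance : Inhabited (RowState₂ S) := ⟨free S⟩

/-- In the free state the stars are not joined. [folklore] -/
theorem not_starsJoined_free (S : Finset ℤ) : ¬ (free S).StarsJoined := by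
  intro h
  have : (RowPoint₂.star S 0) = RowPoint₂.star S 1 := h
  simp [RowPoint₂.star] at this

end RowState₂

/-! ### The edge-by-edge Markov step (verbatim from the one-star file, both stars always up) -/

section Step

variable {S : Finset ℤ}

/-- A row point is *open towards the new row* for the vertical-edge configuration `O ⊆ S`: the
site `x` iff its vertical edge is open (`x ∈ O`); both stars always (they are carried along).
[cite: BondesanJacobsenSaleur2012, §5] -/
def IsUp₂ (O : Finset S) : RowPoint₂ S → Prop
  | Sum.inl x => x ∈ O
  | Sum.inr _ => True

/-- **Vertical layer** (the product `V₁ ⋯ V_L` of single vertical-bond matrices). After adding a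
row whose open vertical edges are those below the sites of `O`, two row points are joined iff they
are equal, or both are open towards the new row and were joined in the old row.
[cite: JacobsenZinnjustin2001, §4] -/
def vertRel₂ (O : Finset S) (π : Setoid (RowPoint₂ S)) : Setoid (RowPoint₂ S) where
  r a b := a = b ∨ (IsUp₂ O a ∧ IsUp₂ O b ∧ π a b)
  iseqv :=
    { refl := fun _ => Or.inl rfl
      symm := by
        rintro a b (rfl | ⟨ha, hb, hab⟩)
        · exact Or.inl rfl
        · exact Or.inr ⟨hb, ha, π.symm hab⟩
      trans := by
        rintro a b c (rfl | ⟨ha, hb, hab⟩) (rfl | ⟨hb', hc, hbc⟩)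
        · exact Or.inl rfl
        · exact Or.inr ⟨hb', hc, hbc⟩
        · exact Or.inr ⟨ha, hb, hab⟩
        · exact Or.inr ⟨ha, hc, π.trans hab hbc⟩ }

/-- Unfolding lemma for `vertRel₂`. [folklore] -/
theorem vertRel₂_apply (O : Finset S) (π : Setoid (RowPoint₂ S)) (a b : RowPoint₂ S) :
    vertRel₂ O π a b ↔ a = b ∨ (IsUp₂ O a ∧ IsUp₂ O b ∧ π a b) :=
  Iff.rfl

/-- The vertical layer does not change whether the two stars are joined. [folklore] -/
theorem starsJoined_vertRel₂ (O : Finset S) (π : RowState₂ S) :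
    (⟨vertRel₂ O π.rel⟩ : RowState₂ S).StarsJoined ↔ π.StarsJoined := by
  change vertRel₂ O π.rel _ _ ↔ π.rel _ _
  rw [vertRel₂_apply]
  constructor
  · rintro (h | ⟨-, -, h⟩)
    · simp [RowPoint₂.star] at h
    · exact h
  · exact fun h => Or.inr ⟨trivial, trivial, h⟩

/-- The partition joining exactly the two row points `a` and `b` (kernel of the map collapsing `b`
onto `a`). [folklore] -/
def joinTwo₂ (a b : RowPoint₂ S) : Setoid (RowPoint₂ S) :=
  Setoid.ker fun c => if c = b then a else c

/-- `joinTwo₂ a b` does join `a` and `b`. [folklore] -/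
theorem joinTwo₂_rel (a b : RowPoint₂ S) : joinTwo₂ a b a b := by
  change (if a = b then a else a) = (if b = b then a else b)
  simp

/-- The partition generated by the open horizontal edge at `x` (joining `x` and `x + 1` when
`x + 1 ∈ S`; trivial otherwise). [cite: BondesanJacobsenSaleur2012, §5] -/
def hEdgeRel₂ (x : S) : Setoid (RowPoint₂ S) :=
  if h : (x : ℤ) + 1 ∈ S then joinTwo₂ (Sum.inl x) (Sum.inl ⟨(x : ℤ) + 1, h⟩) else ⊥

/-- **Horizontal layer** (the product `H₁ ⋯ H_L` of single horizontal-bond matrices). Open the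
horizontal edges labelled by `H`: join, in the lattice of partitions, with the partitions generated
by these edges. [cite: JacobsenZinnjustin2001, §4] -/
def horizRel₂ (H : Finset S) (π : Setoid (RowPoint₂ S)) : Setoid (RowPoint₂ S) :=
  π ⊔ H.sup hEdgeRel₂

/-- Opening edges only joins classes: `π ≤ horizRel₂ H π`. [folklore] -/
theorem le_horizRel₂ (H : Finset S) (π : Setoid (RowPoint₂ S)) : π ≤ horizRel₂ H π :=
  le_sup_left

/-- **One row of bond percolation, given the randomness** (two-star states): vertical edges below
the sites of `O` open, then horizontal edges labelled by `H` open (`T = H₁ ⋯ H_L · V₁ ⋯ V_L`).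
[cite: JacobsenZinnjustin2001, §4] -/
def rowStep₂ (O H : Finset S) (π : RowState₂ S) : RowState₂ S :=
  ⟨horizRel₂ H (vertRel₂ O π.rel)⟩

end Step

/-! ### The stochastic two-star transfer matrix at `p = 1/2` -/

/-- **The row-to-row transfer matrix of bond percolation on `ℤ²` at `p = 1/2` with free side walls,
on two-star connectivity states** over the columns `S`: `T π π'` is the probability that one row
step from `π` produces `π'`, for a uniformly random `O ⊆ S` (i.i.d. Bernoulli(1/2) vertical edges)
and a uniformly random `H ⊆ hEdges S` (i.i.d. Bernoulli(1/2) horizontal edges) — at `p_c = 1/2`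
every bond configuration has the same weight (Jacobsen–Zinn-Justin §3). Distributions act as row
vectors (`μ ᵥ* T`). [cite: JacobsenZinnjustin2001, §3–4] [cite: Cardy2001, §3.3 and §7.1] -/
def PercolationRowTransfer₂ (S : Finset ℤ) : Matrix (RowState₂ S) (RowState₂ S) ℝ :=
  fun π π' =>
    (((univ : Finset (Finset S)) ×ˢ (hEdges S).powerset).filter
        (fun OH => rowStep₂ OH.1 OH.2 π = π')).card /
      ((2 : ℝ) ^ S.card * 2 ^ (hEdges S).card)

/-- Entries of the two-star transfer matrix are nonnegative. [folklore] -/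
theorem percolationRowTransfer₂_nonneg (S : Finset ℤ) (π π' : RowState₂ S) :
    0 ≤ PercolationRowTransfer₂ S π π' := by
  unfold PercolationRowTransfer₂
  positivity

/-- **The two-star transfer matrix is stochastic**: each row sums to `1` (every edge
configuration produces exactly one new pattern). [cite: Cardy2001, §3.3] -/
theorem sum_percolationRowTransfer₂_eq_one (S : Finset ℤ) (π : RowState₂ S) :
    ∑ π', PercolationRowTransfer₂ S π π' = 1 := by
  unfold PercolationRowTransfer₂
  rw [← Finset.sum_div]
  have hpos : (0 : ℝ) < (2 : ℝ) ^ S.card * 2 ^ (hEdges S).card := by positivity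
  rw [div_eq_one_iff_eq hpos.ne', ← card_univ_product_powerset]
  rw [← Nat.cast_sum, Nat.cast_inj]
  symm
  exact card_eq_sum_card_fiberwise fun OH _ => mem_univ (rowStep₂ OH.1 OH.2 π)

/-! ### Wire letters -/

section Wire

variable {S : Finset ℤ}

/-- **Wiring relation**: join every column `a ∈ A` to the star `⋆ i` (the row's vertices lying
on the discrete arc `i` are declared joined to it): `π ⊔ ⨆_{a ∈ A} joinTwo₂ (inl a) (⋆ i)`.
[cite: Cardy2001, §7.1 (boundary states of the marked segments)] -/
def wireRel (A : Finset S) (i : Fin 2) (π : Setoid (RowPoint₂ S)) : Setoid (RowPoint₂ S) :=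
  π ⊔ A.sup fun a => joinTwo₂ (Sum.inl a) (RowPoint₂.star S i)

/-- **The wire letter** `wire A i` on states. [cite: Cardy2001, §7.1] -/
def wire (A : Finset S) (i : Fin 2) (π : RowState₂ S) : RowState₂ S :=
  ⟨wireRel A i π.rel⟩

/-- Wiring only joins classes. [folklore] -/
theorem le_wireRel (A : Finset S) (i : Fin 2) (π : Setoid (RowPoint₂ S)) : π ≤ wireRel A i π :=
  le_sup_left

/-- After wiring, every column of `A` is joined to the star `⋆ i`. [folklore] -/
theorem wire_joins (A : Finset S) (i : Fin 2) (π : RowState₂ S) {a : S} (ha : a ∈ A) :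
    (wire A i π).JoinedToStar a i := by
  have h1 : joinTwo₂ (Sum.inl a) (RowPoint₂.star S i) ≤
      A.sup fun a => joinTwo₂ (Sum.inl a) (RowPoint₂.star S i) :=
    Finset.le_sup (f := fun a : S => joinTwo₂ (Sum.inl a) (RowPoint₂.star S i)) ha
  have h2 : (A.sup fun a => joinTwo₂ (Sum.inl a) (RowPoint₂.star S i)) ≤ wireRel A i π.rel :=
    le_sup_right
  exact h2 (h1 (joinTwo₂_rel _ _))

/-- Wiring nothing is the identity. [folklore] -/
theorem wire_empty (i : Fin 2) (π : RowState₂ S) : wire ∅ i π = π := by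
  unfold wire wireRel
  rw [Finset.sup_empty, sup_bot_eq]

end Wire

/-! ### Junctions: changing the column set (verbatim, stars kept) -/

section Junction

variable {S S' : Finset ℤ}

/-- The inclusion of two-star row points along `S ⊆ S'` (`⋆ i ↦ ⋆ i`). [folklore] -/
def RowPoint₂.incl (h : S ⊆ S') : RowPoint₂ S → RowPoint₂ S'
  | Sum.inl x => Sum.inl ⟨x, h x.2⟩
  | Sum.inr i => Sum.inr i

/-- `RowPoint₂.incl` is injective. [folklore] -/
theorem RowPoint₂.incl_injective (h : S ⊆ S') : Function.Injective (RowPoint₂.incl h) := by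
  rintro (x | u) (y | v) hxy
  · simp only [RowPoint₂.incl, Sum.inl.injEq, Subtype.mk.injEq] at hxy
    exact congrArg Sum.inl (Subtype.ext hxy)
  · simp [RowPoint₂.incl] at hxy
  · simp [RowPoint₂.incl] at hxy
  · simp only [RowPoint₂.incl, Sum.inr.injEq] at hxy
    rw [hxy]

/-- **Insertion `J_{S,S'}`** (`S ⊆ S'`): the new columns become singletons, the old pattern
(including the stars' classes) is kept. [cite: BondesanJacobsenSaleur2012, §5] -/
def insertRel₂ (h : S ⊆ S') (π : Setoid (RowPoint₂ S)) : Setoid (RowPoint₂ S') where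
  r a b := a = b ∨ ∃ a' b', RowPoint₂.incl h a' = a ∧ RowPoint₂.incl h b' = b ∧ π a' b'
  iseqv :=
    { refl := fun _ => Or.inl rfl
      symm := by
        rintro a b (rfl | ⟨a', b', rfl, rfl, hab⟩)
        · exact Or.inl rfl
        · exact Or.inr ⟨b', a', rfl, rfl, π.symm hab⟩
      trans := by
        rintro a b c (rfl | ⟨a', b', rfl, rfl, hab⟩) (h2 | ⟨b'', c', hb, rfl, hbc⟩)
        · exact Or.inl h2
        · exact Or.inr ⟨b'', c', hb, rfl, hbc⟩
        · subst h2
          exact Or.inr ⟨a', b', rfl, rfl, hab⟩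
        · obtain rfl := RowPoint₂.incl_injective h hb
          exact Or.inr ⟨a', c', rfl, rfl, π.trans hab hbc⟩ }

/-- **Restriction `J_{S',S}`** (`S ⊆ S'`): forget the columns outside `S`, keeping the induced
partition of the remaining columns and the two stars (`Setoid.comap` along the inclusion).
[cite: BondesanJacobsenSaleur2012, §5] -/
def restrictRel₂ (h : S ⊆ S') (π' : Setoid (RowPoint₂ S')) : Setoid (RowPoint₂ S) :=
  π'.comap (RowPoint₂.incl h)

/-- Insertion of two-star states. [cite: BondesanJacobsenSaleur2012, §5] -/
def insertState₂ (h : S ⊆ S') (π : RowState₂ S) : RowState₂ S' := ⟨insertRel₂ h π.rel⟩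

/-- Restriction of two-star states. [cite: BondesanJacobsenSaleur2012, §5] -/
def restrictState₂ (h : S ⊆ S') (π' : RowState₂ S') : RowState₂ S := ⟨restrictRel₂ h π'.rel⟩

/-- Restricting an inserted pattern gives it back. [folklore] -/
theorem restrictState₂_insertState₂ (h : S ⊆ S') (π : RowState₂ S) :
    restrictState₂ h (insertState₂ h π) = π := by
  ext a b
  change (insertRel₂ h π.rel) (RowPoint₂.incl h a) (RowPoint₂.incl h b) ↔ π.rel a b
  constructor
  · rintro (hab | ⟨a', b', ha, hb, hab⟩)
    · rw [RowPoint₂.incl_injective h hab]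
    · obtain rfl := RowPoint₂.incl_injective h ha
      obtain rfl := RowPoint₂.incl_injective h hb
      exact hab
  · intro hab
    exact Or.inr ⟨a, b, rfl, rfl, hab⟩

/-- Restriction does not change whether the two stars are joined. [folklore] -/
theorem starsJoined_restrictState₂ (h : S ⊆ S') (π' : RowState₂ S') :
    (restrictState₂ h π').StarsJoined ↔ π'.StarsJoined :=
  Iff.rfl

/-- Insertion does not change whether the two stars are joined. [folklore] -/
theorem starsJoined_insertState₂ (h : S ⊆ S') (π : RowState₂ S) :
    (insertState₂ h π).StarsJoined ↔ π.StarsJoined := by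
  rw [← starsJoined_restrictState₂ h (insertState₂ h π), restrictState₂_insertState₂]

end Junction

/-! ### Boundary data: initial vector and read-out -/

/-- **The initial vector**: the Dirac mass at the free (all-singletons) state — nothing is joined
below the lowest row. [cite: Cardy2001, §7.1] -/
def rowInit₂ (S : Finset ℤ) : RowState₂ S → ℝ :=
  fun π => if π = RowState₂.free S then 1 else 0

/-- **The read-out functional**: indicator that the two stars are joined (an open path from the
discrete arc `(ab)` to the discrete arc `(cd)` exists). [cite: Cardy2001, §7.1] -/
def rowReadout₂ (S : Finset ℤ) : RowState₂ S → ℝ :=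
  fun π => if π.StarsJoined then 1 else 0

/-- The initial vector is a probability vector. [folklore] -/
theorem sum_rowInit₂ (S : Finset ℤ) : ∑ π, rowInit₂ S π = 1 := by
  simp [rowInit₂, Finset.sum_ite_eq']

/-- The initial vector is nonnegative. [folklore] -/
theorem rowInit₂_nonneg (S : Finset ℤ) (π : RowState₂ S) : 0 ≤ rowInit₂ S π := by
  unfold rowInit₂
  split_ifs <;> norm_num

/-- `0 ≤ read-out ≤ 1`. [folklore] -/
theorem rowReadout₂_mem_Icc (S : Finset ℤ) (π : RowState₂ S) :
    rowReadout₂ S π ∈ Set.Icc (0 : ℝ) 1 := by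
  unfold rowReadout₂
  split_ifs <;> norm_num

/-- The read-out of the initial state is `0` (no crossing before any row). [folklore] -/
theorem rowReadout₂_free (S : Finset ℤ) : rowReadout₂ S (RowState₂.free S) = 0 := by
  simp [rowReadout₂, RowState₂.not_starsJoined_free]

/-! ### Linear letters on distributions -/

section Linear

variable {ι κ : Type*} [Fintype ι] [Fintype κ]

omit [Fintype κ] in
/-- Push-forward preserves nonnegativity. [folklore] -/
theorem statePushforward_nonneg (f : ι → κ) {μ : ι → ℝ} (hμ : ∀ i, 0 ≤ μ i) (k : κ) :
    0 ≤ statePushforward f μ k := by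
  simp only [statePushforward, LinearMap.coe_mk, AddHom.coe_mk]
  exact Finset.sum_nonneg fun i _ => hμ i

variable {S S' : Finset ℤ}

/-- **The junction letter `J_{S,S'}`** on distributions of two-star states (`S ⊆ S'`).
[cite: BondesanJacobsenSaleur2012, §5] -/
def junctionInsert₂ (h : S ⊆ S') : (RowState₂ S → ℝ) →ₗ[ℝ] (RowState₂ S' → ℝ) :=
  statePushforward (insertState₂ h)

/-- **The junction letter `J_{S',S}`** on distributions of two-star states (`S ⊆ S'`).
[cite: BondesanJacobsenSaleur2012, §5] -/
def junctionRestrict₂ (h : S ⊆ S') : (RowState₂ S' → ℝ) →ₗ[ℝ] (RowState₂ S → ℝ) :=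
  statePushforward (restrictState₂ h)

/-- **The wire letter** on distributions: push-forward along `wire A i`. [cite: Cardy2001, §7.1] -/
def wirePush (A : Finset S) (i : Fin 2) : (RowState₂ S → ℝ) →ₗ[ℝ] (RowState₂ S → ℝ) :=
  statePushforward (wire A i)

/-- The two-star transfer matrix as a linear map on distributions (row vectors): `μ ↦ μ ᵥ* T`.
[cite: Cardy2001, §3.3] -/
def transferLin₂ (S : Finset ℤ) : (RowState₂ S → ℝ) →ₗ[ℝ] (RowState₂ S → ℝ) :=
  (PercolationRowTransfer₂ S).vecMulLinear

/-- The transfer step preserves the total mass of a distribution (stochasticity).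
[cite: Cardy2001, §3.3] -/
theorem sum_transferLin₂ (S : Finset ℤ) (μ : RowState₂ S → ℝ) :
    ∑ π', transferLin₂ S μ π' = ∑ π, μ π := by
  simp only [transferLin₂, Matrix.vecMulLinear_apply, Matrix.vecMul, dotProduct]
  rw [Finset.sum_comm]
  refine Finset.sum_congr rfl fun π _ => ?_
  rw [← Finset.mul_sum, sum_percolationRowTransfer₂_eq_one, mul_one]

/-- The transfer step preserves nonnegativity. [folklore] -/
theorem transferLin₂_nonneg (S : Finset ℤ) {μ : RowState₂ S → ℝ} (hμ : ∀ π, 0 ≤ μ π)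
    (π' : RowState₂ S) : 0 ≤ transferLin₂ S μ π' := by
  simp only [transferLin₂, Matrix.vecMulLinear_apply, Matrix.vecMul, dotProduct]
  exact Finset.sum_nonneg fun π _ => mul_nonneg (hμ π) (percolationRowTransfer₂_nonneg S π π')

/-- **One letter of a polygon word** — one lattice row: from a distribution of connectivity
states over the columns `S` of the previous row to the columns `S'` of the current row: restrict
to `S ∩ S'` (columns that stop), insert into `S'` (columns that start, as singletons), apply the
transfer matrix `T_{S'}` (vertical edges — immaterial below inserted singletons — then horizontal
edges), then wire the columns `W_A` to `⋆_A` and `W_B` to `⋆_B`.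
[cite: BondesanJacobsenSaleur2012, §5] [cite: Cardy2001, §7.1] -/
def rowLetter (S S' : Finset ℤ) (WA WB : Finset S') :
    (RowState₂ S → ℝ) →ₗ[ℝ] (RowState₂ S' → ℝ) :=
  (wirePush WB 1).comp <| (wirePush WA 0).comp <| (transferLin₂ S').comp <|
    (junctionInsert₂ (Finset.inter_subset_right : S ∩ S' ⊆ S')).comp
      (junctionRestrict₂ (Finset.inter_subset_left : S ∩ S' ⊆ S))

/-- A letter preserves the total mass. [folklore] -/
theorem sum_rowLetter (S S' : Finset ℤ) (WA WB : Finset S') (μ : RowState₂ S → ℝ) :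
    ∑ π', rowLetter S S' WA WB μ π' = ∑ π, μ π := by
  simp only [rowLetter, LinearMap.comp_apply, wirePush, junctionInsert₂, junctionRestrict₂,
    sum_statePushforward, sum_transferLin₂]

/-- A letter preserves nonnegativity. [folklore] -/
theorem rowLetter_nonneg (S S' : Finset ℤ) (WA WB : Finset S') {μ : RowState₂ S → ℝ}
    (hμ : ∀ π, 0 ≤ μ π) (π' : RowState₂ S') : 0 ≤ rowLetter S S' WA WB μ π' := by
  simp only [rowLetter, LinearMap.comp_apply, wirePush, junctionInsert₂, junctionRestrict₂]
  refine statePushforward_nonneg _ (fun _ => statePushforward_nonneg _ (fun _ => ?_) _) _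
  exact transferLin₂_nonneg _
    (fun _ => statePushforward_nonneg _ (fun _ => statePushforward_nonneg _ hμ _) _) _

end Linear

/-! ### Rows and columns of a finite vertex set; the word and its amplitude -/

section Word

/-- The columns of row `y` of the finite vertex set `V ⊆ ℤ²`: `{x | (x, y) ∈ V}`. [folklore] -/
def rowCols (V : Finset (Site 2)) (y : ℤ) : Finset ℤ :=
  (V.filter fun v => v 1 = y).image fun v => v 0

/-- Membership in `rowCols`. [folklore] -/
theorem mem_rowCols {V : Finset (Site 2)} {y x : ℤ} : x ∈ rowCols V y ↔ (![x, y] : Site 2) ∈ V := by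
  simp only [rowCols, mem_image, mem_filter]
  constructor
  · rintro ⟨v, ⟨hv, rfl⟩, rfl⟩
    convert hv using 1
    ext i
    fin_cases i <;> rfl
  · intro h
    exact ⟨![x, y], ⟨h, rfl⟩, rfl⟩

/-- The columns of row `y` (column set `S`) whose vertex `(x, y)` lies in the wire set `W`
(a discrete arc). [folklore] -/
def rowWires (W : Set (Site 2)) (S : Finset ℤ) (y : ℤ) : Finset S :=
  univ.filter fun x : S => (![(x : ℤ), y] : Site 2) ∈ W

/-- Membership in `rowWires`. [folklore] -/
theorem mem_rowWires {W : Set (Site 2)} {S : Finset ℤ} {y : ℤ} {x : S} :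
    x ∈ rowWires W S y ↔ (![(x : ℤ), y] : Site 2) ∈ W := by
  simp [rowWires]

/-- **The word, as a running distribution.** `latticeWordDist V W_A W_B b n` is the
distribution of the two-star connectivity state of row `b + n` (over its columns
`rowCols V (b + n)`) produced by the rows `b + 1, …, b + n` of `V` with i.i.d. Bernoulli(1/2)
edges, the vertices of `W_A` / `W_B` in these rows being wired to `⋆_A` / `⋆_B`; row `b` carries
the initial vector `rowInit₂` (so `b` should lie below every row of `V`). It is the row vector
`α · L_{b+1} ⋯ L_{b+n}` of the letters `rowLetter`.
[cite: Cardy2001, §7.1] [cite: BondesanJacobsenSaleur2012, §5] -/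
def latticeWordDist (V : Finset (Site 2)) (WA WB : Set (Site 2)) (b : ℤ) :
    (n : ℕ) → RowState₂ (rowCols V (b + n)) → ℝ
  | 0 => rowInit₂ _
  | n + 1 =>
    rowLetter (rowCols V (b + n)) (rowCols V (b + (n + 1 : ℕ)))
      (rowWires WA _ (b + (n + 1 : ℕ))) (rowWires WB _ (b + (n + 1 : ℕ)))
      (latticeWordDist V WA WB b n)

/-- The running distribution is a probability vector. [folklore] -/
theorem sum_latticeWordDist (V : Finset (Site 2)) (WA WB : Set (Site 2)) (b : ℤ) (n : ℕ) :
    ∑ π, latticeWordDist V WA WB b n π = 1 := by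
  induction n with
  | zero => exact sum_rowInit₂ _
  | succ n ih => rw [latticeWordDist, sum_rowLetter, ih]

/-- The running distribution is nonnegative. [folklore] -/
theorem latticeWordDist_nonneg (V : Finset (Site 2)) (WA WB : Set (Site 2)) (b : ℤ) (n : ℕ)
    (π : RowState₂ (rowCols V (b + n))) : 0 ≤ latticeWordDist V WA WB b n π := by
  induction n with
  | zero => exact rowInit₂_nonneg _ _
  | succ n ih => exact rowLetter_nonneg _ _ _ _ ih _

/-- **The amplitude of the word** `⟨α| L_{b+1} ⋯ L_{b+n} |β⟩`: the probability, under the word's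
final distribution, that the two stars are joined. [cite: Cardy2001, §7.1] -/
def latticeWordAmplitude (V : Finset (Site 2)) (WA WB : Set (Site 2)) (b : ℤ) (n : ℕ) : ℝ :=
  ∑ π, latticeWordDist V WA WB b n π * rowReadout₂ _ π

/-- Word amplitudes are probabilities. [folklore] -/
theorem latticeWordAmplitude_mem_Icc (V : Finset (Site 2)) (WA WB : Set (Site 2)) (b : ℤ) (n : ℕ) :
    latticeWordAmplitude V WA WB b n ∈ Set.Icc (0 : ℝ) 1 := by
  constructor
  · exact Finset.sum_nonneg fun π _ =>
      mul_nonneg (latticeWordDist_nonneg V WA WB b n π) (rowReadout₂_mem_Icc _ π).1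
  · calc ∑ π, latticeWordDist V WA WB b n π * rowReadout₂ _ π
        ≤ ∑ π, latticeWordDist V WA WB b n π := Finset.sum_le_sum fun π _ =>
          mul_le_of_le_one_right (latticeWordDist_nonneg V WA WB b n π) (rowReadout₂_mem_Icc _ π).2
      _ = 1 := sum_latticeWordDist V WA WB b n

/-- The rows met by `V`. [folklore] -/
def occupiedRows (V : Finset (Site 2)) : Finset ℤ := V.image fun v => v 1

/-- The base row of `V`: one below its lowest row (junk `0` for `V = ∅`). [folklore] -/
def wordBaseRow (V : Finset (Site 2)) : ℤ :=
  if h : V.Nonempty then (occupiedRows V).min' (h.image _) - 1 else 0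

/-- The number of rows to process: from `wordBaseRow V + 1` up to the highest row of `V`
(junk `0` for `V = ∅`). [folklore] -/
def wordRowCount (V : Finset (Site 2)) : ℕ :=
  if h : V.Nonempty then ((occupiedRows V).max' (h.image _) - wordBaseRow V).toNat else 0

/-- Every row of `V` lies in the processed window
`(wordBaseRow V, wordBaseRow V + wordRowCount V]`. [folklore] -/
theorem wordBaseRow_lt_and_le {V : Finset (Site 2)} {v : Site 2} (hv : v ∈ V) :
    wordBaseRow V < v 1 ∧ v 1 ≤ wordBaseRow V + wordRowCount V := by
  have hne : V.Nonempty := ⟨v, hv⟩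
  have hmem : v 1 ∈ occupiedRows V := mem_image_of_mem (fun v : Site 2 => v 1) hv
  have hmin := (occupiedRows V).min'_le _ hmem
  have hmax := (occupiedRows V).le_max' _ hmem
  simp only [wordBaseRow, wordRowCount, hne, dif_pos]
  refine ⟨by omega, ?_⟩
  rw [Int.toNat_of_nonneg (by omega)]
  omega

/-- **The lattice crossing amplitude** of the finite vertex set `V ⊆ ℤ²` with wire sets `W_A`,
`W_B`: the word amplitude over all rows of `V` (bond percolation at `p = 1/2` on the subgraph of
`ℤ²` induced by `V`; the event "some vertex of `W_A ∩ V` is joined inside `V` to some vertex of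
`W_B ∩ V`", computed row by row). [cite: Cardy2001, §7.1] -/
def latticeCrossingAmplitude (V : Finset (Site 2)) (WA WB : Set (Site 2)) : ℝ :=
  latticeWordAmplitude V WA WB (wordBaseRow V) (wordRowCount V)

/-- Lattice crossing amplitudes are probabilities. [folklore] -/
theorem latticeCrossingAmplitude_mem_Icc (V : Finset (Site 2)) (WA WB : Set (Site 2)) :
    latticeCrossingAmplitude V WA WB ∈ Set.Icc (0 : ℝ) 1 :=
  latticeWordAmplitude_mem_Icc V WA WB _ _

end Word

/-! ### The word of a marked lattice polygon (G02 discretisation) -/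

section Polygon

/-- **The transfer-matrix word amplitude of a conformal rectangle `R = (Ω; a, b, c, d)` at mesh
`δ`**: the lattice crossing amplitude of the G02 discrete domain `Ω_δ`
(`meshDomainFinset R.carrier δ`, bounded carrier and `δ > 0`; empty otherwise) wired along the
G02 discrete arcs `discreteArc Ω δ (ab)` (to `⋆_A`) and `discreteArc Ω δ (cd)` (to `⋆_B`), ties
of the `≤` closest-arc rule going to both stars exactly as in `discreteCrossing`. For a marked
lattice polygon at an aligned mesh this is the word `⟨α| T … J … wire … T |β⟩` of the polyomino
(`RowTransferExactness`). [cite: Cardy2001, §7.1] [cite: BondesanJacobsenSaleur2012, §5] -/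
def polygonWordAmplitude (R : RandomPlanarGeometry.ConformalRectangle) (δ : ℝ) : ℝ :=
  latticeCrossingAmplitude (meshDomainFinset R.carrier δ)
    (discreteArc R.carrier δ (R.arc 0)) (discreteArc R.carrier δ (R.arc 2))

/-- Polygon word amplitudes are probabilities. [folklore] -/
theorem polygonWordAmplitude_mem_Icc (R : RandomPlanarGeometry.ConformalRectangle) (δ : ℝ) :
    polygonWordAmplitude R δ ∈ Set.Icc (0 : ℝ) 1 :=
  latticeCrossingAmplitude_mem_Icc _ _ _

/-- **The open polyomino** of the finite set `s` of closed `δ₀`-lattice squares: the interior of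
`⋃_{p ∈ s} [δ₀ p₁, δ₀ (p₁ + 1)] × [δ₀ p₂, δ₀ (p₂ + 1)] ⊆ ℂ` — literally the carrier hypothesis of
`CardyLatticePolygon` (route `CriticalPhenomena/CardyPolygonWords`). [folklore] -/
def polyominoCarrier (δ₀ : ℝ) (s : Finset (ℤ × ℤ)) : Set ℂ :=
  interior (⋃ p ∈ s, {z : ℂ | δ₀ * (p.1 : ℝ) ≤ z.re ∧ z.re ≤ δ₀ * ((p.1 : ℝ) + 1) ∧
    δ₀ * (p.2 : ℝ) ≤ z.im ∧ z.im ≤ δ₀ * ((p.2 : ℝ) + 1)})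

/-- **Row-transfer exactness** (the lattice dictionary; bookkeeping, filed as support item
`RowTransferExactness` of route `CriticalPhenomena/CardyPolygonWords`). For a conformal rectangle
whose carrier is an open polyomino of `δ₀`-squares, at every aligned mesh `δ = δ₀ / N` the G02
crossing probability of bond percolation on `ℤ²` at `p = 1/2` IS the word amplitude:
`bondDomainCrossingProb R δ = polygonWordAmplitude R δ`. Proof sketch (only the first step is
formalised here, `discreteDomainGraph_adj_iff_polyomino` below): at an aligned mesh every
`ℤ²`-edge between two vertices of `Ω_δ` has its closed segment inside `Ω̄`, so
`discreteDomainGraph` is the subgraph of `ℤ²` induced on `meshDomain`; the open edges inside it are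
i.i.d. Bernoulli(1/2) (cylinder marginal of `bondPercolation (zdGraph 2) half`); and the
partition of row `y ⊔ {⋆_A, ⋆_B}` induced by open paths through rows `≤ y` (stars standing for
the discrete-arc vertices met so far) is a function of the previous row's partition and the
edges of row `y`, namely restrict–vertical–insert–horizontal–wire, whose law given the previous
state is the letter `rowLetter`; the crossing event `discreteCrossing` is `StarsJoined` at the
top. The marks need not be lattice points and `N ≥ 1` suffices. This is the finite-lattice form
of "the crossing probability is a matrix element of a product of transfer matrices between
boundary states" (Cardy, arXiv:math-ph/0103018, §7.1, `P = ⟨a|e^{-WH}|b⟩`; Bondesan–Jacobsen–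
Saleur, arXiv:1207.7005, §5, lattice amplitudes `⟨B| T^{L'} |B'⟩`); the precise identity for the
G02 discretisation is elementary bookkeeping with no single printed source. [folklore] -/
def RowTransferExactness : Prop :=
  ∀ (R : RandomPlanarGeometry.ConformalRectangle) (δ₀ : ℝ) (s : Finset (ℤ × ℤ)) (N : ℕ),
    0 < δ₀ → 0 < N → R.carrier = polyominoCarrier δ₀ s →
      Percolation.bondDomainCrossingProb R (δ₀ / N) = polygonWordAmplitude R (δ₀ / N)

end Polygon

/-! ### Aligned meshes of polyominoes: `Ω_δ` is an induced subgraph of `ℤ²` -/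

section PolyominoMesh

open Complex

/-- The closed `δ₀`-square of the lattice `δ₀ℤ²` with lower-left corner `δ₀ • p`. [folklore] -/
def polyominoSquare (δ₀ : ℝ) (p : ℤ × ℤ) : Set ℂ :=
  {z : ℂ | δ₀ * (p.1 : ℝ) ≤ z.re ∧ z.re ≤ δ₀ * ((p.1 : ℝ) + 1) ∧
    δ₀ * (p.2 : ℝ) ≤ z.im ∧ z.im ≤ δ₀ * ((p.2 : ℝ) + 1)}

/-- `polyominoCarrier` is the interior of the union of its squares (definitional). [folklore] -/
theorem polyominoCarrier_eq (δ₀ : ℝ) (s : Finset (ℤ × ℤ)) :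
    polyominoCarrier δ₀ s = interior (⋃ p ∈ s, polyominoSquare δ₀ p) :=
  rfl

/-- A polyomino square as a product of two real intervals. [folklore] -/
theorem polyominoSquare_eq_reProdIm (δ₀ : ℝ) (p : ℤ × ℤ) :
    polyominoSquare δ₀ p =
      Set.Icc (δ₀ * p.1) (δ₀ * (p.1 + 1)) ×ℂ Set.Icc (δ₀ * p.2) (δ₀ * (p.2 + 1)) := by
  ext z
  simp only [polyominoSquare, Set.mem_setOf_eq, Complex.mem_reProdIm, Set.mem_Icc, and_assoc]

/-- Polyomino squares are convex. [folklore] -/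
theorem convex_polyominoSquare (δ₀ : ℝ) (p : ℤ × ℤ) : Convex ℝ (polyominoSquare δ₀ p) := by
  have h : polyominoSquare δ₀ p =
      ({z : ℂ | δ₀ * (p.1 : ℝ) ≤ z.re} ∩ {z : ℂ | z.re ≤ δ₀ * ((p.1 : ℝ) + 1)}) ∩
        ({z : ℂ | δ₀ * (p.2 : ℝ) ≤ z.im} ∩ {z : ℂ | z.im ≤ δ₀ * ((p.2 : ℝ) + 1)}) := by
    ext z
    simp only [polyominoSquare, Set.mem_setOf_eq, Set.mem_inter_iff, and_assoc]
  rw [h]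
  exact ((convex_halfSpace_re_ge _).inter (convex_halfSpace_re_le _)).inter
    ((convex_halfSpace_im_ge _).inter (convex_halfSpace_im_le _))

/-- For `δ₀ > 0` a polyomino square is the closure of its interior (it is a non-degenerate closed
box). [folklore] -/
theorem polyominoSquare_subset_closure_interior {δ₀ : ℝ} (hδ₀ : 0 < δ₀) (p : ℤ × ℤ) :
    polyominoSquare δ₀ p ⊆ closure (interior (polyominoSquare δ₀ p)) := by
  have h1 : δ₀ * (p.1 : ℝ) < δ₀ * ((p.1 : ℝ) + 1) := by nlinarith
  have h2 : δ₀ * (p.2 : ℝ) < δ₀ * ((p.2 : ℝ) + 1) := by nlinarith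
  rw [polyominoSquare_eq_reProdIm, Complex.interior_reProdIm, interior_Icc, interior_Icc,
    Complex.closure_reProdIm, closure_Ioo h1.ne, closure_Ioo h2.ne]

variable {δ₀ : ℝ} {s : Finset (ℤ × ℤ)} {N : ℕ}

/-- Scaling an integer inequality `a ≤ N b` to mesh coordinates. [folklore] -/
private theorem mesh_le_of_le (hδ₀ : 0 < δ₀) (hN : 0 < N) {a : ℤ} {b : ℝ}
    (h : (a : ℝ) ≤ N * b) : δ₀ / N * a ≤ δ₀ * b := by
  have hN' : (0 : ℝ) < N := by exact_mod_cast hN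
  rw [div_mul_eq_mul_div, div_le_iff₀ hN']
  nlinarith

/-- Scaling an integer inequality `N b ≤ a` to mesh coordinates. [folklore] -/
private theorem mesh_ge_of_ge (hδ₀ : 0 < δ₀) (hN : 0 < N) {a : ℤ} {b : ℝ}
    (h : N * b ≤ (a : ℝ)) : δ₀ * b ≤ δ₀ / N * a := by
  have hN' : (0 : ℝ) < N := by exact_mod_cast hN
  rw [div_mul_eq_mul_div, le_div_iff₀ hN']
  nlinarith

/-- Floor bookkeeping: `N (a / N) ≤ a` and `a + 1 ≤ N (a / N + 1)` for `N > 0`, cast to `ℝ`.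
[folklore] -/
private theorem ediv_bounds (hN : 0 < N) (a : ℤ) :
    (N : ℝ) * ((a / N : ℤ) : ℝ) ≤ a ∧ (a : ℝ) + 1 ≤ N * (((a / N : ℤ) : ℝ) + 1) := by
  have hN' : (0 : ℤ) < N := by exact_mod_cast hN
  have h1 : (N : ℤ) * (a / N) ≤ a := Int.mul_ediv_self_le (ne_of_gt hN')
  have h2 : a < (N : ℤ) * (a / N + 1) := by
    rw [mul_add, mul_one]
    exact Int.lt_mul_ediv_self_add hN'
  constructor
  · exact_mod_cast h1
  · have : a + 1 ≤ (N : ℤ) * (a / N + 1) := h2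
    exact_mod_cast this

/-- **The probe lemma.** If the mesh point `(δ₀/N) x` of a site lies in the open polyomino, then
the `δ₀`-square whose lower-left corner is `δ₀ (⌊x₀/N⌋, ⌊x₁/N⌋)` belongs to the polyomino
(probe the open set slightly up-right of the point). [folklore] -/
theorem floorSquare_mem_of_mem_meshVertices (hδ₀ : 0 < δ₀) (hN : 0 < N) {x : Site 2}
    (hx : x ∈ meshVertices (polyominoCarrier δ₀ s) (δ₀ / N)) :
    (x 0 / N, x 1 / N) ∈ s := by
  have hN' : (0 : ℝ) < N := by exact_mod_cast hN
  rw [mem_meshVertices_iff, polyominoCarrier_eq, mem_interior_iff_mem_nhds,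
    Metric.mem_nhds_iff] at hx
  obtain ⟨ε, hε, hball⟩ := hx
  obtain ⟨hk1, hk2⟩ := ediv_bounds hN (x 0)
  obtain ⟨hl1, hl2⟩ := ediv_bounds hN (x 1)
  set k : ℤ := x 0 / N with hk
  set l : ℤ := x 1 / N with hl
  -- the probe point `z = δ x + t (1 + i)`
  set t : ℝ := min (ε / 4) (δ₀ / (2 * N)) with ht
  have ht0 : 0 < t := lt_min (by linarith) (by positivity)
  have htε : t ≤ ε / 4 := min_le_left _ _
  have htδ : t ≤ δ₀ / (2 * N) := min_le_right _ _
  have htδ' : t < δ₀ / N := by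
    have : δ₀ / (2 * N) < δ₀ / N := by
      rw [div_lt_div_iff₀ (by positivity) hN']
      nlinarith
    exact htδ.trans_lt this
  set z : ℂ := meshPoint (δ₀ / N) x + ((t : ℂ) + (t : ℂ) * Complex.I) with hz
  have hzre : z.re = δ₀ / N * x 0 + t := by simp [hz]
  have hzim : z.im = δ₀ / N * x 1 + t := by simp [hz]
  have hzmem : z ∈ Metric.ball (meshPoint (δ₀ / N) x) ε := by
    rw [Metric.mem_ball, Complex.dist_eq, hz, add_sub_cancel_left]
    refine (Complex.norm_le_abs_re_add_abs_im _).trans_lt ?_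
    simp only [Complex.add_re, Complex.ofReal_re, Complex.mul_re, Complex.I_re, mul_zero,
      Complex.ofReal_im, Complex.I_im, mul_one, sub_self, add_zero, Complex.add_im,
      Complex.mul_im, zero_add]
    rw [abs_of_pos ht0]
    linarith
  obtain ⟨q, hq, hzq⟩ : ∃ q ∈ s, z ∈ polyominoSquare δ₀ q := by
    simpa only [Set.mem_iUnion, exists_prop] using hball hzmem
  obtain ⟨hq1, hq2, hq3, hq4⟩ := hzq
  rw [hzre] at hq1 hq2
  rw [hzim] at hq3 hq4
  -- the probe point lies in the OPEN floor square
  have hre_lo : δ₀ * (k : ℝ) < δ₀ / N * x 0 + t := by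
    have := mesh_ge_of_ge hδ₀ hN hk1
    linarith
  have hre_hi : δ₀ / N * x 0 + t < δ₀ * ((k : ℝ) + 1) := by
    have h := mesh_le_of_le hδ₀ hN (a := x 0 + 1) (b := (k : ℝ) + 1) (by push_cast; linarith)
    have e : δ₀ / N * ((x 0 + 1 : ℤ) : ℝ) = δ₀ / N * x 0 + δ₀ / N := by push_cast; ring
    linarith
  have him_lo : δ₀ * (l : ℝ) < δ₀ / N * x 1 + t := by
    have := mesh_ge_of_ge hδ₀ hN hl1
    linarith
  have him_hi : δ₀ / N * x 1 + t < δ₀ * ((l : ℝ) + 1) := by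
    have h := mesh_le_of_le hδ₀ hN (a := x 1 + 1) (b := (l : ℝ) + 1) (by push_cast; linarith)
    have e : δ₀ / N * ((x 1 + 1 : ℤ) : ℝ) = δ₀ / N * x 1 + δ₀ / N := by push_cast; ring
    linarith
  -- hence `q = (k, l)`
  have e1 : q.1 = k := by
    have a1 : (q.1 : ℝ) < k + 1 := lt_of_mul_lt_mul_left (hq1.trans_lt hre_hi) hδ₀.le
    have a2 : (k : ℝ) < q.1 + 1 := lt_of_mul_lt_mul_left (hre_lo.trans_le hq2) hδ₀.le
    have b1 : q.1 < k + 1 := by exact_mod_cast a1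
    have b2 : k < q.1 + 1 := by exact_mod_cast a2
    omega
  have e2 : q.2 = l := by
    have a1 : (q.2 : ℝ) < l + 1 := lt_of_mul_lt_mul_left (hq3.trans_lt him_hi) hδ₀.le
    have a2 : (l : ℝ) < q.2 + 1 := lt_of_mul_lt_mul_left (him_lo.trans_le hq4) hδ₀.le
    have b1 : q.2 < l + 1 := by exact_mod_cast a1
    have b2 : l < q.2 + 1 := by exact_mod_cast a2
    omega
  have : q = (k, l) := Prod.ext e1 e2
  rw [this] at hq
  exact hq

/-- The mesh point of a site lies in the floor square of the site. [folklore] -/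
theorem meshPoint_mem_floorSquare (hδ₀ : 0 < δ₀) (hN : 0 < N) (x : Site 2) :
    meshPoint (δ₀ / N) x ∈ polyominoSquare δ₀ (x 0 / N, x 1 / N) := by
  obtain ⟨hk1, hk2⟩ := ediv_bounds hN (x 0)
  obtain ⟨hl1, hl2⟩ := ediv_bounds hN (x 1)
  refine ⟨?_, ?_, ?_, ?_⟩ <;> simp only [meshPoint_re, meshPoint_im]
  · exact mesh_ge_of_ge hδ₀ hN hk1
  · exact mesh_le_of_le hδ₀ hN (by linarith)
  · exact mesh_ge_of_ge hδ₀ hN hl1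
  · exact mesh_le_of_le hδ₀ hN (by linarith)

/-- The mesh points of the right and upper neighbours of a site lie in the floor square of the
site (this is where the mesh must be ALIGNED: `x₀ + 1 ≤ N (⌊x₀/N⌋ + 1)`). [folklore] -/
theorem meshPoint_add_single_mem_floorSquare (hδ₀ : 0 < δ₀) (hN : 0 < N) (x : Site 2)
    (i : Fin 2) :
    meshPoint (δ₀ / N) (x + Pi.single i 1) ∈ polyominoSquare δ₀ (x 0 / N, x 1 / N) := by
  obtain ⟨hk1, hk2⟩ := ediv_bounds hN (x 0)
  obtain ⟨hl1, hl2⟩ := ediv_bounds hN (x 1)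
  have e00 : (x + Pi.single (0 : Fin 2) 1 : Site 2) 0 = x 0 + 1 := by simp
  have e01 : (x + Pi.single (0 : Fin 2) 1 : Site 2) 1 = x 1 := by simp
  have e10 : (x + Pi.single (1 : Fin 2) 1 : Site 2) 0 = x 0 := by simp
  have e11 : (x + Pi.single (1 : Fin 2) 1 : Site 2) 1 = x 1 + 1 := by simp
  fin_cases i
  · refine ⟨?_, ?_, ?_, ?_⟩ <;> simp only [meshPoint_re, meshPoint_im, Fin.zero_eta, e00, e01]
    · exact mesh_ge_of_ge hδ₀ hN (by push_cast; linarith)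
    · exact mesh_le_of_le hδ₀ hN (by push_cast; linarith)
    · exact mesh_ge_of_ge hδ₀ hN hl1
    · exact mesh_le_of_le hδ₀ hN (by linarith)
  · refine ⟨?_, ?_, ?_, ?_⟩ <;> simp only [meshPoint_re, meshPoint_im, Fin.mk_one, e10, e11]
    · exact mesh_ge_of_ge hδ₀ hN hk1
    · exact mesh_le_of_le hδ₀ hN (by linarith)
    · exact mesh_ge_of_ge hδ₀ hN (by push_cast; linarith)
    · exact mesh_le_of_le hδ₀ hN (by push_cast; linarith)

/-- A polyomino square of the polyomino lies in the closure of the open polyomino. [folklore] -/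
theorem polyominoSquare_subset_closure_polyominoCarrier (hδ₀ : 0 < δ₀) {p : ℤ × ℤ}
    (hp : p ∈ s) : polyominoSquare δ₀ p ⊆ closure (polyominoCarrier δ₀ s) := by
  refine (polyominoSquare_subset_closure_interior hδ₀ p).trans (closure_mono ?_)
  rw [polyominoCarrier_eq]
  exact interior_mono (Set.subset_biUnion_of_mem (u := fun p => polyominoSquare δ₀ p) hp)

/-- **At an aligned mesh `δ₀ / N`, every `ℤ²`-edge between two vertices of the discretised
polyomino is an edge of the mesh graph** (its closed segment lies in `Ω̄`): the discrete domain
of a lattice polygon is an INDUCED subgraph of `ℤ²`. [folklore] -/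
theorem meshGraph_adj_of_zdGraph_adj_polyomino (hδ₀ : 0 < δ₀) (hN : 0 < N) {x y : Site 2}
    (hx : x ∈ meshVertices (polyominoCarrier δ₀ s) (δ₀ / N))
    (hy : y ∈ meshVertices (polyominoCarrier δ₀ s) (δ₀ / N)) (hxy : (zdGraph 2).Adj x y) :
    (meshGraph (polyominoCarrier δ₀ s) (δ₀ / N)).Adj x y := by
  -- reduce to `y = x + eᵢ` using the symmetry of both adjacency relations
  suffices key : ∀ {x y : Site 2}, x ∈ meshVertices (polyominoCarrier δ₀ s) (δ₀ / N) →
      (zdGraph 2).Adj x y → (∃ i, y = x + Pi.single i 1) →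
      (meshGraph (polyominoCarrier δ₀ s) (δ₀ / N)).Adj x y by
    obtain ⟨i, h | h⟩ := (zdGraph_adj_iff x y).1 hxy
    · exact key hx hxy ⟨i, h⟩
    · exact (key hy hxy.symm ⟨i, h⟩).symm
  intro x y hx hxy ⟨i, hi⟩
  rw [meshGraph_adj_iff]
  refine ⟨hxy, ?_⟩
  have hsq := floorSquare_mem_of_mem_meshVertices hδ₀ hN hx
  refine ((convex_polyominoSquare δ₀ (x 0 / N, x 1 / N)).segment_subset
    (meshPoint_mem_floorSquare hδ₀ hN x) ?_).trans
    (polyominoSquare_subset_closure_polyominoCarrier hδ₀ hsq)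
  rw [hi]
  exact meshPoint_add_single_mem_floorSquare hδ₀ hN x i

/-- Consequently, at an aligned mesh the graph `Ω_δ` of a lattice polygon is the subgraph of `ℤ²`
induced on `meshDomain`: adjacency in `discreteDomainGraph` is `ℤ²`-adjacency of two vertices of
`meshDomain`. [folklore] -/
theorem discreteDomainGraph_adj_iff_polyomino (hδ₀ : 0 < δ₀) (hN : 0 < N) {x y : Site 2} :
    (discreteDomainGraph (polyominoCarrier δ₀ s) (δ₀ / N)).Adj x y ↔
      (zdGraph 2).Adj x y ∧ x ∈ meshDomain (polyominoCarrier δ₀ s) (δ₀ / N) ∧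
        y ∈ meshDomain (polyominoCarrier δ₀ s) (δ₀ / N) := by
  rw [discreteDomainGraph_adj_iff]
  constructor
  · rintro ⟨h, hx, hy⟩
    exact ⟨meshGraph_le_zdGraph _ _ h, hx, hy⟩
  · rintro ⟨h, hx, hy⟩
    exact ⟨meshGraph_adj_of_zdGraph_adj_polyomino hδ₀ hN
      (meshDomain_subset_meshVertices _ _ hx) (meshDomain_subset_meshVertices _ _ hy) h, hx, hy⟩

end PolyominoMesh

end Literature.Probability.LatticeModels

end
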